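import Mathlib.Analysis.Calculus.InverseFunctionTheorem.FDeriv
import Mathlib.Analysis.Calculus.ContDiff.RCLike
import Mathlib.Analysis.Calculus.ContDiff.Operations
import Mathlib.Analysis.Calculus.Deriv.Prod
import Mathlib.Analysis.Calculus.Deriv.Comp
import Mathlib.Analysis.Normed.Operator.Banach
import Mathlib.Topology.Algebra.Module.FiniteDimension
import HarnessLib

/-!
# Transverse double points of plane curves persist in `C¹` families

Topic `Literature/Topology/FourManifolds`; an analytic brick of the direction `→` of Reidemeister's
theorem in Gauss-diagram form (the named fact `Knot.reidemeisterR` of `RasmussenWellDefinedR.lean`),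
namely of the *stability* step: along an ambient isotopy the Gauss diagram read on the fixed
stereographic projection does not change as long as the plane curve stays generic, because each
transverse crossing moves continuously and no crossing is created or destroyed nearby.

* `exists_doublePoint_track` — let `γ : ℝ → ℝ → ℝ × ℝ` be a family of plane curves, jointly `Cⁿ`
  (`n ≠ 0`) in `(t, θ)`, and let `(a, b)` be a **transverse double point** of `γ 0`
  (`γ 0 a = γ 0 b`, `det (γ₀' a, γ₀' b) ≠ 0`). Then there are `δ > 0` and functions `σ, υ`,
  continuous on `(-δ, δ)`, with `σ 0 = a`, `υ 0 = b`, `γ t (σ t) = γ t (υ t)` for `|t| < δ`, and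
  **uniqueness**: for `|t| < δ` the only solution of `γ t s = γ t u` with `|s - a| < δ`,
  `|u - b| < δ` is `(s, u) = (σ t, υ t)`.

Proof: the inverse function theorem (Mathlib's `HasStrictFDerivAt.toOpenPartialHomeomorph`) for
`Ψ (t, (s, u)) = (t, γ t s - γ t u)` at `(0, (a, b))`, whose differential
`(τ, (ξ, η)) ↦ (τ, A (τ, ξ) - B (τ, η))` (`A, B` the differentials of `γ` at `(0, a)`, `(0, b)`;
`A (0, ξ) = ξ • γ₀' a`) is injective by transversality, hence invertible; the track is
`t ↦ Ψ⁻¹ (t, 0)`. This is the simplest instance of the stability of transversal intersections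
(Guillemin–Pollack (1974), Ch. 1 §6, Stability Theorem). Everything here is proved; no named facts.

## References

* V. Guillemin, A. Pollack, *Differential Topology* (1974), Ch. 1 §5–§6 (transversality is stable).
  [cite: GuilleminPollack2010, Ch. 1 §6]
* M. W. Hirsch, *Differential Topology*, GTM 33 (1976), Ch. 2 §1 (openness of embeddings and
  immersions). [HirschDT1976]
-/

open Function Set Filter Metric Topology

noncomputable section

namespace Literature.Topology.FourManifolds

namespace DoublePointPersistence

variable {γ : ℝ → ℝ → ℝ × ℝ} {n : WithTop ℕ∞}

/-- The partial derivative in the curve parameter is the differential of the family applied to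
`(0, 1)`. [folklore] -/
theorem deriv_eq_fderiv_uncurry (hγ : ContDiff ℝ n (uncurry γ)) (hn : n ≠ 0) (t θ : ℝ) :
    deriv (γ t) θ = fderiv ℝ (uncurry γ) (t, θ) (0, 1) := by
  have hd : HasFDerivAt (uncurry γ) (fderiv ℝ (uncurry γ) (t, θ)) (t, θ) :=
    ((hγ.differentiable hn) (t, θ)).hasFDerivAt
  have hl : HasDerivAt (fun s : ℝ ↦ ((t, s) : ℝ × ℝ)) ((0 : ℝ), (1 : ℝ)) θ :=
    (hasDerivAt_const θ t).prodMk (hasDerivAt_id θ)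
  have hc := hd.comp_hasDerivAt θ hl
  exact hc.deriv

/-- The differential of the family applied to `(0, ξ)` is `ξ •` the velocity of the curve.
[folklore] -/
theorem fderiv_uncurry_apply_zero (hγ : ContDiff ℝ n (uncurry γ)) (hn : n ≠ 0) (t θ ξ : ℝ) :
    fderiv ℝ (uncurry γ) (t, θ) (0, ξ) = ξ • deriv (γ t) θ := by
  rw [deriv_eq_fderiv_uncurry hγ hn, ← map_smul]
  congr 1
  ext <;> simp

/-- The map `Ψ (t, (s, u)) = (t, γ t s - γ t u)` of the proof. [folklore] -/
def psi (γ : ℝ → ℝ → ℝ × ℝ) (p : ℝ × (ℝ × ℝ)) : ℝ × (ℝ × ℝ) :=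
  (p.1, γ p.1 p.2.1 - γ p.1 p.2.2)

/-- `Ψ` is as smooth as the family. [folklore] -/
theorem contDiff_psi (hγ : ContDiff ℝ n (uncurry γ)) : ContDiff ℝ n (psi γ) := by
  have h1 : ContDiff ℝ n fun p : ℝ × (ℝ × ℝ) ↦ uncurry γ (p.1, p.2.1) :=
    hγ.comp₂ contDiff_fst (contDiff_fst.comp contDiff_snd)
  have h2 : ContDiff ℝ n fun p : ℝ × (ℝ × ℝ) ↦ uncurry γ (p.1, p.2.2) :=
    hγ.comp₂ contDiff_fst (contDiff_snd.comp contDiff_snd)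
  exact contDiff_fst.prodMk (h1.sub h2)

/-- The candidate differential of `Ψ` at `(t, (s, u))`: `(τ, (ξ, η)) ↦ (τ, A (τ, ξ) - B (τ, η))`.
[folklore] -/
def psiDeriv (γ : ℝ → ℝ → ℝ × ℝ) (p : ℝ × (ℝ × ℝ)) : ℝ × (ℝ × ℝ) →L[ℝ] ℝ × (ℝ × ℝ) :=
  (ContinuousLinearMap.fst ℝ ℝ (ℝ × ℝ)).prod
    ((fderiv ℝ (uncurry γ) (p.1, p.2.1)).comp
        ((ContinuousLinearMap.fst ℝ ℝ (ℝ × ℝ)).prod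
          ((ContinuousLinearMap.fst ℝ ℝ ℝ).comp (ContinuousLinearMap.snd ℝ ℝ (ℝ × ℝ)))) -
      (fderiv ℝ (uncurry γ) (p.1, p.2.2)).comp
        ((ContinuousLinearMap.fst ℝ ℝ (ℝ × ℝ)).prod
          ((ContinuousLinearMap.snd ℝ ℝ ℝ).comp (ContinuousLinearMap.snd ℝ ℝ (ℝ × ℝ)))))

/-- The value of the candidate differential. [folklore] -/
theorem psiDeriv_apply (p v : ℝ × (ℝ × ℝ)) :
    psiDeriv γ p v = (v.1, fderiv ℝ (uncurry γ) (p.1, p.2.1) (v.1, v.2.1)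
      - fderiv ℝ (uncurry γ) (p.1, p.2.2) (v.1, v.2.2)) :=
  rfl

/-- `Ψ` has the candidate differential as a strict derivative. [folklore] -/
theorem hasStrictFDerivAt_psi (hγ : ContDiff ℝ n (uncurry γ)) (hn : n ≠ 0) (p : ℝ × (ℝ × ℝ)) :
    HasStrictFDerivAt (psi γ) (psiDeriv γ p) p := by
  have hA : HasStrictFDerivAt (uncurry γ) (fderiv ℝ (uncurry γ) (p.1, p.2.1)) (p.1, p.2.1) :=
    hγ.contDiffAt.hasStrictFDerivAt hn
  have hB : HasStrictFDerivAt (uncurry γ) (fderiv ℝ (uncurry γ) (p.1, p.2.2)) (p.1, p.2.2) :=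
    hγ.contDiffAt.hasStrictFDerivAt hn
  set π₁ : ℝ × (ℝ × ℝ) →L[ℝ] ℝ × ℝ := (ContinuousLinearMap.fst ℝ ℝ (ℝ × ℝ)).prod
    ((ContinuousLinearMap.fst ℝ ℝ ℝ).comp (ContinuousLinearMap.snd ℝ ℝ (ℝ × ℝ))) with hπ₁
  set π₂ : ℝ × (ℝ × ℝ) →L[ℝ] ℝ × ℝ := (ContinuousLinearMap.fst ℝ ℝ (ℝ × ℝ)).prod
    ((ContinuousLinearMap.snd ℝ ℝ ℝ).comp (ContinuousLinearMap.snd ℝ ℝ (ℝ × ℝ))) with hπ₂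
  have h1 : HasStrictFDerivAt (fun q : ℝ × (ℝ × ℝ) ↦ uncurry γ (q.1, q.2.1))
      ((fderiv ℝ (uncurry γ) (p.1, p.2.1)).comp π₁) p :=
    hA.comp p π₁.hasStrictFDerivAt
  have h2 : HasStrictFDerivAt (fun q : ℝ × (ℝ × ℝ) ↦ uncurry γ (q.1, q.2.2))
      ((fderiv ℝ (uncurry γ) (p.1, p.2.2)).comp π₂) p :=
    hB.comp p π₂.hasStrictFDerivAt
  exact (ContinuousLinearMap.fst ℝ ℝ (ℝ × ℝ)).hasStrictFDerivAt.prodMk (h1.sub h2)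

/-- **Transversality makes the differential injective**: if `det (γ₀' a, γ₀' b) ≠ 0` then
`psiDeriv γ (0, (a, b))` is injective. [folklore] -/
theorem eq_zero_of_psiDeriv_eq_zero (hγ : ContDiff ℝ n (uncurry γ)) (hn : n ≠ 0) {t a b : ℝ}
    (hdet : (deriv (γ t) a).1 * (deriv (γ t) b).2 - (deriv (γ t) a).2 * (deriv (γ t) b).1 ≠ 0)
    {v : ℝ × (ℝ × ℝ)} (hv : psiDeriv γ (t, (a, b)) v = 0) : v = 0 := by
  obtain ⟨τ, ξ, η⟩ := v
  rw [psiDeriv_apply] at hv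
  simp only [Prod.mk_eq_zero] at hv
  obtain ⟨rfl, h2⟩ := hv
  rw [fderiv_uncurry_apply_zero hγ hn, fderiv_uncurry_apply_zero hγ hn, sub_eq_zero,
    Prod.ext_iff] at h2
  simp only [Prod.smul_fst, Prod.smul_snd, smul_eq_mul] at h2
  obtain ⟨h2a, h2b⟩ := h2
  have hξ : ξ * ((deriv (γ t) a).1 * (deriv (γ t) b).2 - (deriv (γ t) a).2 * (deriv (γ t) b).1)
      = 0 := by
    linear_combination (deriv (γ t) b).2 * h2a - (deriv (γ t) b).1 * h2b
  have hη : η * ((deriv (γ t) a).1 * (deriv (γ t) b).2 - (deriv (γ t) a).2 * (deriv (γ t) b).1)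
      = 0 := by
    linear_combination (deriv (γ t) a).2 * h2a - (deriv (γ t) a).1 * h2b
  have hξ0 : ξ = 0 := (mul_eq_zero.1 hξ).resolve_right hdet
  have hη0 : η = 0 := (mul_eq_zero.1 hη).resolve_right hdet
  subst hξ0; subst hη0
  rfl

/-- **Transversality makes the differential injective**: if `det (γ' a, γ' b) ≠ 0` then
`psiDeriv γ (t, (a, b))` is injective. [folklore] -/
theorem psiDeriv_injective (hγ : ContDiff ℝ n (uncurry γ)) (hn : n ≠ 0) {t a b : ℝ}
    (hdet : (deriv (γ t) a).1 * (deriv (γ t) b).2 - (deriv (γ t) a).2 * (deriv (γ t) b).1 ≠ 0) :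
    Injective (psiDeriv γ (t, (a, b))) := fun v w h ↦
  sub_eq_zero.1 (eq_zero_of_psiDeriv_eq_zero hγ hn hdet (by rw [map_sub, h, sub_self]))

/-- The invertible differential, as a continuous linear equivalence. [folklore] -/
def psiDerivEquiv (hγ : ContDiff ℝ n (uncurry γ)) (hn : n ≠ 0) {t a b : ℝ}
    (hdet : (deriv (γ t) a).1 * (deriv (γ t) b).2 - (deriv (γ t) a).2 * (deriv (γ t) b).1 ≠ 0) :
    (ℝ × (ℝ × ℝ)) ≃L[ℝ] (ℝ × (ℝ × ℝ)) :=
  ContinuousLinearEquiv.ofBijective (psiDeriv γ (t, (a, b)))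
    (LinearMap.ker_eq_bot.2 (psiDeriv_injective hγ hn hdet))
    (LinearMap.range_eq_top.2 (LinearMap.surjective_of_injective
      (f := (psiDeriv γ (t, (a, b))).toLinearMap) (psiDeriv_injective hγ hn hdet)))

/-- The equivalence is the candidate differential. [folklore] -/
theorem coe_psiDerivEquiv (hγ : ContDiff ℝ n (uncurry γ)) (hn : n ≠ 0) {t a b : ℝ}
    (hdet : (deriv (γ t) a).1 * (deriv (γ t) b).2 - (deriv (γ t) a).2 * (deriv (γ t) b).1 ≠ 0) :
    ((psiDerivEquiv hγ hn hdet : (ℝ × (ℝ × ℝ)) ≃L[ℝ] (ℝ × (ℝ × ℝ))) : ℝ × (ℝ × ℝ) →L[ℝ] ℝ × (ℝ × ℝ))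
      = psiDeriv γ (t, (a, b)) :=
  ContinuousLinearEquiv.coe_ofBijective _ _ _

end DoublePointPersistence

open DoublePointPersistence in
/-- **Transverse double points persist in `C¹` families of plane curves.** Let
`γ : ℝ → ℝ → ℝ × ℝ` be jointly `Cⁿ`, `n ≥ 1`, and let `(a, b)` be a transverse double point of
`γ t₀`: `γ t₀ a = γ t₀ b` and `det (γ' a, γ' b) ≠ 0`. Then for some `δ > 0` there are functions
`σ, υ`, continuous on `(t₀ - δ, t₀ + δ)`, with `σ t₀ = a`, `υ t₀ = b`, tracking the double point —
`γ t (σ t) = γ t (υ t)` for `|t - t₀| < δ` — and it is the only double point nearby: for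
`|t - t₀| < δ`, `|s - a| < δ`, `|u - b| < δ`, `γ t s = γ t u` forces `s = σ t` and `u = υ t`
(inverse function theorem for `(t, s, u) ↦ (t, γ t s - γ t u)`). Guillemin–Pollack (1974),
Ch. 1 §6 (stability of transversal intersection). [cite: GuilleminPollack2010, Ch. 1 §6] -/
theorem exists_doublePoint_track {γ : ℝ → ℝ → ℝ × ℝ} {n : WithTop ℕ∞}
    (hγ : ContDiff ℝ n (uncurry γ)) (hn : n ≠ 0) {t₀ a b : ℝ} (hab : γ t₀ a = γ t₀ b)
    (hdet : (deriv (γ t₀) a).1 * (deriv (γ t₀) b).2 - (deriv (γ t₀) a).2 * (deriv (γ t₀) b).1 ≠ 0) :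
    ∃ (δ : ℝ) (σ υ : ℝ → ℝ), 0 < δ ∧ ContinuousOn σ (Ioo (t₀ - δ) (t₀ + δ)) ∧
      ContinuousOn υ (Ioo (t₀ - δ) (t₀ + δ)) ∧ σ t₀ = a ∧ υ t₀ = b ∧
      (∀ t, |t - t₀| < δ → γ t (σ t) = γ t (υ t)) ∧
      ∀ t s u, |t - t₀| < δ → |s - a| < δ → |u - b| < δ → γ t s = γ t u → s = σ t ∧ u = υ t := by
  set p₀ : ℝ × (ℝ × ℝ) := (t₀, (a, b)) with hp₀
  have hΨ : HasStrictFDerivAt (psi γ)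
      ((psiDerivEquiv hγ hn hdet : (ℝ × (ℝ × ℝ)) ≃L[ℝ] (ℝ × (ℝ × ℝ))) : ℝ × (ℝ × ℝ) →L[ℝ] ℝ × (ℝ × ℝ))
      p₀ := by
    rw [coe_psiDerivEquiv]
    exact hasStrictFDerivAt_psi hγ hn p₀
  set Φ := hΨ.toOpenPartialHomeomorph (psi γ) with hΦ
  have hΦf : (Φ : ℝ × (ℝ × ℝ) → ℝ × (ℝ × ℝ)) = psi γ := hΨ.toOpenPartialHomeomorph_coe
  have hsrc : p₀ ∈ Φ.source := hΨ.mem_toOpenPartialHomeomorph_source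
  have htgt : psi γ p₀ ∈ Φ.target := hΨ.image_mem_toOpenPartialHomeomorph_target
  have hΨ₀ : psi γ p₀ = (t₀, 0) := by
    simp only [psi, hp₀, hab, sub_self]
  -- radii: `r` for the target around `(t₀, 0)`, `r'` for the source around `p₀`
  obtain ⟨r, hr, hrT⟩ := Metric.isOpen_iff.1 Φ.open_target _ htgt
  obtain ⟨r', hr', hrS⟩ := Metric.isOpen_iff.1 Φ.open_source _ hsrc
  rw [hΨ₀] at hrT
  -- the track
  set g : ℝ → ℝ × (ℝ × ℝ) := fun t ↦ Φ.symm (t, 0) with hg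
  have hmemT : ∀ t, |t - t₀| < r → ((t, (0 : ℝ × ℝ)) : ℝ × (ℝ × ℝ)) ∈ Φ.target := fun t ht ↦
    hrT (by
      rw [mem_ball, Prod.dist_eq, dist_self, Real.dist_eq]
      exact max_lt ht (lt_of_le_of_lt le_rfl (lt_of_le_of_lt (abs_nonneg _) ht)))
  have hg_eq : ∀ t, |t - t₀| < r → psi γ (g t) = (t, 0) := fun t ht ↦ by
    rw [← hΦf]
    exact Φ.right_inv (hmemT t ht)
  have hg_src : ∀ t, |t - t₀| < r → g t ∈ Φ.source := fun t ht ↦ Φ.map_target (hmemT t ht)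
  have hg₀ : g t₀ = p₀ := by
    have := Φ.left_inv hsrc
    rwa [hΦf, hΨ₀] at this
  have hg1 : ∀ t, |t - t₀| < r → (g t).1 = t := fun t ht ↦ by
    have := congrArg Prod.fst (hg_eq t ht)
    exact this
  have hg2 : ∀ t, |t - t₀| < r → γ t (g t).2.1 = γ t (g t).2.2 := fun t ht ↦ by
    have h := congrArg Prod.snd (hg_eq t ht)
    simp only [psi] at h
    rw [hg1 t ht] at h
    exact sub_eq_zero.1 h
  -- continuity of the track on `|t - t₀| < r`
  have hg_cont : ContinuousOn g (Ioo (t₀ - r) (t₀ + r)) := by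
    refine Φ.continuousOn_symm.comp (Continuous.continuousOn (by fun_prop)) fun t ht ↦ hmemT t ?_
    rw [abs_sub_lt_iff]
    constructor <;> linarith [ht.1, ht.2]
  refine ⟨min r r', fun t ↦ (g t).2.1, fun t ↦ (g t).2.2, lt_min hr hr', ?_, ?_, ?_, ?_, ?_, ?_⟩
  · refine (continuous_fst.comp continuous_snd).comp_continuousOn (hg_cont.mono ?_)
    exact Ioo_subset_Ioo (by linarith [min_le_left r r']) (by linarith [min_le_left r r'])
  · refine (continuous_snd.comp continuous_snd).comp_continuousOn (hg_cont.mono ?_)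
    exact Ioo_subset_Ioo (by linarith [min_le_left r r']) (by linarith [min_le_left r r'])
  · simp only [hg₀, hp₀]
  · simp only [hg₀, hp₀]
  · intro t ht
    exact hg2 t (lt_of_lt_of_le ht (min_le_left _ _))
  · intro t s u ht hs hu hsu
    have htr : |t - t₀| < r := lt_of_lt_of_le ht (min_le_left _ _)
    have hq : ((t, (s, u)) : ℝ × (ℝ × ℝ)) ∈ Φ.source := hrS (by
      rw [mem_ball, Prod.dist_eq, Prod.dist_eq, Real.dist_eq, Real.dist_eq, Real.dist_eq]
      exact max_lt (lt_of_lt_of_le ht (min_le_right _ _))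
        (max_lt (lt_of_lt_of_le hs (min_le_right _ _)) (lt_of_lt_of_le hu (min_le_right _ _))))
    have heq : psi γ (t, (s, u)) = psi γ (g t) := by
      rw [hg_eq t htr]
      simp only [psi, hsu, sub_self]
    have := Φ.injOn hq (hg_src t htr) (by rw [hΦf]; exact heq)
    exact ⟨(congrArg (fun q : ℝ × (ℝ × ℝ) ↦ q.2.1) this :), (congrArg (fun q : ℝ × (ℝ × ℝ) ↦ q.2.2) this :)⟩

end Literature.Topology.FourManifolds
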